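import Summits.FinalStateConjecture.FinalStateConjecture.Theses.ZeroEnergyKerrOrBomb
import Literature.Geometry.Lorentzian.StationaryBlackHoleUniquenessProofs
import Literature.Geometry.Lorentzian.CausalityOpennessProofs
import Literature.Geometry.Lorentzian.StaticBlackHoleUniquenessProofs

/-!
# Disproof of `NonTrappingHawkingRigidity` (crux `stmt-FinalStateConjecture-13896`, routes
`ZeroEnergyKerrOrBomb` #2 / `AnalyticityInvadesErgoregion` #4, shared) — findings

Standing adversary file of the cdisprove seat `refuter-cdisprove-stmt-FinalStateConjecture-13896-0`
(cycle 1, 2026-08-17).  Prose lives in docstrings; every `theorem` without `sorry` is kernel-checked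
(`lean check` rc 0); `sorry` appears ONLY in § (c)/(e) (two near-misses), each with witness and
obstruction.  Read with the sister file `Cruxes/ZeroEnergyRigidity/Disproof.lean` (crux 10690, same
route, rev-4 typing), whose (F2)/(F5) produced the present mod-`T` typing of h16.

## Findings (index)

* **(F0) Elaborates; the served body is the telescope** `iff_telescope` (`Iff.rfl`): hypotheses
  `H1 … H16` (h1 vacuum, h2 `I⁺`-regular, h3 future-presented, h4 `T ≠ 0` on doc, h5 `π₁(doc) = 0`,
  h6–h8 `U` open ⊇ connected `𝓔⁺`, h9–h14 the Killing–timelike collar `K` on `U`, h15 belt compact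
  mod `T`, h16 no maximal zero-energy null geodesic trapped mod `T`) and `Conclusion` (a `T`-commuting
  Killing `K'` on doc docking with `K` on `U' ∩ doc`, `U' ⊇ 𝓔⁺` open).
* **NO KILL** (`junk_survey` §1–2): as typed the item is WEAKER than the Alexakis–Ionescu–Klainerman
  conjecture (IonescuKlainerman2015 §4) — the collar, `I⁺`-regularity, future presentation and the
  belt are GIVEN and only the Hawking extension is concluded; a refutation is a counterexample to that
  conjecture (none in print) or a junk inhabitant, and the junk surface is closed: `𝓔⁺ = ∅` excluded
  by h8 and TRUE anyway (`conclusion_of_horizon_empty`), static collars TRUE (`conclusion_of_collar_parallel`),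
  `U ⊇ doc` TRUE (`conclusion_of_doc_subset`), Kerr-with-junk-`K` impossible (`K = c(T + Ω_H Φ)` forced),
  `T + cΦ` not admissible as `𝓑.killing`, quotients/covers killed by h5 / the `S²` AF end.
* **(F1) h4 is decoration — LANDED p135370** (`Theorems/NonTrappingHawkingRigidity/Negative/
  KillingNonvanishingOfIPlusRegular.lean`): `h2 → h4` for every presentation (Chruściel–Costa 2008
  Cor. 3.8, tree theorem `IsIPlusRegular.killing_ne_zero_of_mem_doc`), `NonTrappingHawkingRigidity ↔`
  itself minus h4 (`h4_of_h2`, `iff_withoutH4` here; verbatim Theses-free form landed).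
* **(F2)/(F3)/(F3′) trivial TRUE branches** (kernel): `doc ⊆ U`; `K = c • T` on `U₀ ∩ doc` (the whole
  NON-ROTATING case — the docstring gloss "(⇒ axisymmetry)" fails there but is not claimed); `𝓔⁺ = ∅`.
  The content of the item is entirely the ROTATING case.
* **(F4) `K ↦ c • K`, `c ≠ 0`, leaves h9–h14 and the conclusion invariant** (kernel:
  `collar_const_smul_iff`, `conclusion_const_smul_iff`; verbatim Theses-free form submitted as
  `Theorems/NonTrappingHawkingRigidity/Negative/CollarScaling.lean`, p135673): orientation and scale
  of the collar field (`κ`, "future-directed", the number `Ω_H`) are not in the hypotheses; stubs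
  must normalise first.
* **(F5) h1 (vacuum) IS load-bearing, in the `T`-TIMELIKE region** (near-miss `false_without_H1`,
  sorried): a `T`-invariant non-axisymmetric `C²`-small bump of rotating Kerr supported in a `T`-tube
  inside `{g(T,T) < 0}` keeps h2–h16 VERBATIM (same horizon, collar, ergoregion, belt, zero-energy
  optics) and kills the extension (local Killing algebra of Kerr + 1-jet rigidity).  MESSAGE: any proof
  must use `Ric = 0` on `{g(T,T) < 0} ∖ U` too (analyticity à la Müller zum Hagen / Carleman across the
  automatically `T`-pseudo-convex level sets there), not only in the belt where h16 works.
* **(F6) the `∃ U'` of the conclusion is necessary** (near-miss `not_dockOnU`, sorried): two-component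
  `U` on Kerr (collar + far tube with `K := T`) satisfies h6–h16 but no `K'` docks on all of `U ∩ doc`.
  The planner's typing is right; provers dock on the horizon component only.
* **(F7) remarks** (`junk_survey` §3–7): h13 constrains only WHOLE-LINE `K`-curves (tangency must be
  derived from h14 + continuity, or completeness proved); h15 shapes `U` only inside the ergoregion
  (pinching at the poles; `U` neither connected nor `T`-invariant — WLOG `T`-invariant needs Killing
  1-jet rigidity along `𝓔⁺`); `T ↦ cT` invisible (sister (F10)); h5 believed redundant (topological
  censorship, no tree fact); h14 excludes extreme Kerr, which however SATISFIES the conclusion — h14 is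
  load-bearing for the method (`κ ≠ 0`), not visibly for truth; h16 dropped = unconditional smooth
  rigidity (open); `∃!`-strengthening true on paper; "`K'` timelike on doc" false on Kerr.
* **(F8) docking is non-vacuous** (kernel): `𝓔⁺ ⊆ closure doc` for every presentation (tree
  theorem, CCH12 §2.4), so every open `U' ⊇ 𝓔⁺` meets doc when `𝓔⁺ ≠ ∅` — `K' := 0`, `K' := c • T` are
  dead in the rotating case.
* **(F9) pre-triage of the round-1 cards' first lemmas** (`ideas_pretriage`): all four survive the
  disprover's junk probes (degenerate branches `Z ∥ T`, `Φ := T`, `S := ∅` are TRUE instances; the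
  non-`T`-invariant max-height argument needs translates + uniform UC neighbourhoods — noted).
* **Targets**: none this cycle (`payload.targets = []`, no line picked yet).

## For the lead / ideators (what this file predicts about stubs)

Any stub of the form "the collar field continues across the ergoregion belt ⇒ done" is exposed to
(F5): the continuation OUTSIDE the belt, through `{g(T,T) < 0}`, is where vacuum (or analyticity)
must enter again.  Any stub quantifying "the `κ` / `Ω_H` of `K`" is ill-posed before a normalisation
((F4), sister (F9)/(F10)).  Any stub asserting a property of `U` as a whole (connected, `T`-invariant,
"`K' = K` on `U`") is false ((F6), (F7).4); restrict to the horizon component / an explicit sub-collar.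
-/

set_option linter.dupNamespace false

namespace Summit.FinalStateConjecture.FinalStateConjecture.Cruxes.NonTrappingHawkingRigidity.Disproof

open Literature.Geometry.Lorentzian
open scoped Manifold ContDiff Topology
open Summit.FinalStateConjecture.FinalStateConjecture.Theses.ZeroEnergyKerrOrBomb
  (NonTrappingHawkingRigidity)

noncomputable section

variable (𝓑 : StationaryAFBlackHole.{0})

/-! ## § (F0) The telescope, hypothesis by hypothesis -/

/-- h1 — vacuum. -/
def H1 [𝓑.metric.HasLeviCivita] : Prop := 𝓑.metric.toPseudoRiemannianMetric.IsRicciFlat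
/-- h2 — `I⁺`-regular (Chruściel–Costa Def. 1.1). -/
def H2 : Prop := 𝓑.IsIPlusRegular
/-- h3 — future-presented: every event lies in `I⁺(M_ext)`. -/
def H3 : Prop := ∀ p : 𝓑.carrier, p ∈ 𝓑.metric.chronologicalFuture 𝓑.timeOrientation 𝓑.Mext
/-- h4 — `T ≠ 0` on the d.o.c. -/
def H4 : Prop := ∀ p ∈ 𝓑.doc, 𝓑.killing p ≠ 0
/-- h5 — the d.o.c. is simply connected. -/
def H5 : Prop := SimplyConnectedSpace 𝓑.doc

variable (U : Set 𝓑.carrier) (K : Π x : 𝓑.carrier, TangentSpace (𝓡 4) x)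

/-- h6 — `U` open. -/
def H6 : Prop := IsOpen U
/-- h7 — `U ⊇ 𝓔⁺`. -/
def H7 : Prop := 𝓑.horizon ⊆ U
/-- h8 — `𝓔⁺` connected (hence non-empty). -/
def H8 : Prop := IsConnected 𝓑.horizon
/-- h9 — `K` smooth on `U`. -/
def H9 : Prop := ContMDiffOn (𝓡 4) ((𝓡 4).prod 𝓘(ℝ, E4)) ((⊤ : ℕ∞) : WithTop ℕ∞)
  (fun x ↦ (Bundle.TotalSpace.mk' E4 x (K x) : TangentBundle (𝓡 4) 𝓑.carrier)) U
/-- h10 — `K` Killing on `U`. -/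
def H10 [𝓑.metric.HasLeviCivita] : Prop := ∀ x ∈ U, ∀ v w : TangentSpace (𝓡 4) x,
  𝓑.metric.val x (𝓑.metric.leviCivita K x v) w + 𝓑.metric.val x v (𝓑.metric.leviCivita K x w) = 0
/-- h11 — `[T, K] = 0` on `U`. -/
def H11 : Prop := ∀ x ∈ U, VectorField.mlieBracket (𝓡 4) 𝓑.killing K x = 0
/-- h12 — `K ≠ 0` on `𝓔⁺`. -/
def H12 : Prop := ∀ p ∈ 𝓑.horizon, K p ≠ 0
/-- h13 — `K` tangent to `𝓔⁺` (whole-line integral curves from `𝓔⁺` stay in `𝓔⁺`). -/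
def H13 : Prop := ∀ γ : ℝ → 𝓑.carrier, IsMIntegralCurve γ K → γ 0 ∈ 𝓑.horizon → ∀ t, γ t ∈ 𝓑.horizon
/-- h14 — `K` timelike on `U ∩ doc` (the Killing–TIMELIKE collar). -/
def H14 : Prop := ∀ x ∈ U ∩ 𝓑.doc, 𝓑.metric.val x (K x) (K x) < 0
/-- h15 — the closed ergoregion off `U` is compact modulo `T`. -/
def H15 : Prop := ∃ S₀ : Set 𝓑.carrier, IsCompact S₀ ∧ S₀ ⊆ 𝓑.doc ∧ ∀ y ∈ 𝓑.doc,
  0 ≤ 𝓑.metric.val y (𝓑.killing y) (𝓑.killing y) → y ∉ U → y ∈ stationaryOrbit 𝓑.killing S₀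
/-- h16 — no maximal zero-energy null geodesic is trapped modulo the flow of `T`. -/
def H16 [𝓑.metric.HasLeviCivita] : Prop := ∀ S : Set 𝓑.carrier, IsCompact S → S ⊆ 𝓑.doc →
  ∀ (γ : ℝ → 𝓑.carrier) (s : Set ℝ),
    IsMaximalGeodesicOn 𝓑.metric.toPseudoRiemannianMetric.leviCivita γ s → s.Nonempty →
    (∀ t ∈ s, 𝓑.metric.val (γ t) (velocity (𝓡 4) γ t) (velocity (𝓡 4) γ t) = 0 ∧
      velocity (𝓡 4) γ t ≠ 0 ∧ 𝓑.metric.val (γ t) (velocity (𝓡 4) γ t) (𝓑.killing (γ t)) = 0) →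
    ∃ t ∈ s, γ t ∉ stationaryOrbit 𝓑.killing S
/-- The conclusion: the collar field extends to a `T`-commuting Killing field `K'` on the d.o.c.,
docking with `K` on `U' ∩ doc` for some open `U' ⊇ 𝓔⁺`. -/
def Conclusion [𝓑.metric.HasLeviCivita] : Prop :=
  ∃ K' : Π x : 𝓑.carrier, TangentSpace (𝓡 4) x,
  ContMDiffOn (𝓡 4) ((𝓡 4).prod 𝓘(ℝ, E4)) ((⊤ : ℕ∞) : WithTop ℕ∞)
    (fun x ↦ (Bundle.TotalSpace.mk' E4 x (K' x) : TangentBundle (𝓡 4) 𝓑.carrier)) 𝓑.doc ∧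
  (∀ x ∈ 𝓑.doc, ∀ v w : TangentSpace (𝓡 4) x,
    𝓑.metric.val x (𝓑.metric.leviCivita K' x v) w + 𝓑.metric.val x v (𝓑.metric.leviCivita K' x w) = 0) ∧
  (∀ x ∈ 𝓑.doc, VectorField.mlieBracket (𝓡 4) 𝓑.killing K' x = 0) ∧
  ∃ U' : Set 𝓑.carrier, IsOpen U' ∧ 𝓑.horizon ⊆ U' ∧ ∀ x ∈ U' ∩ 𝓑.doc, K' x = K x

/-- **(F0) The served body is the telescope `h1 → … → h16 → Conclusion`** (definitional). -/
theorem iff_telescope : NonTrappingHawkingRigidity ↔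
    ∀ (𝓑 : StationaryAFBlackHole.{0}) [𝓑.metric.HasLeviCivita],
      H1 𝓑 → H2 𝓑 → H3 𝓑 → H4 𝓑 → H5 𝓑 →
      ∀ (U : Set 𝓑.carrier) (K : Π x : 𝓑.carrier, TangentSpace (𝓡 4) x),
        H6 𝓑 U → H7 𝓑 U → H8 𝓑 → H9 𝓑 U K → H10 𝓑 U K → H11 𝓑 U K → H12 𝓑 K → H13 𝓑 K →
        H14 𝓑 U K → H15 𝓑 U → H16 𝓑 → Conclusion 𝓑 K :=
  Iff.rfl


/-! ## § (a) Load-bearing analysis — kernel-checked part -/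

/-- **(F1) h4 is NOT load-bearing: h2 ⇒ h4 for every presentation.** An `I⁺`-regular black hole
has `T ≠ 0` on its d.o.c. — Chruściel–Costa 2008, Cor. 3.8 in its `I⁺`-regular form, PROVED in the
tree (`StationaryAFBlackHole.IsIPlusRegular.killing_ne_zero_of_mem_doc`: strong causality on the
globally hyperbolic set `⟨⟨M_ext⟩⟩` forbids the closed timelike curve that Lemma 3.7 builds from a
zero of the complete field `T`). [cite: ChruscielCosta2008, Cor. 3.8] -/
theorem h4_of_h2 [𝓑.metric.HasLeviCivita] (h2 : H2 𝓑) : H4 𝓑 :=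
  fun _ hp ↦ StationaryAFBlackHole.IsIPlusRegular.killing_ne_zero_of_mem_doc h2 hp

/-- The crux with hypothesis h4 (`T ≠ 0` on the d.o.c.) DELETED. -/
def WithoutH4 : Prop :=
  ∀ (𝓑 : StationaryAFBlackHole.{0}) [𝓑.metric.HasLeviCivita],
    H1 𝓑 → H2 𝓑 → H3 𝓑 → H5 𝓑 →
    ∀ (U : Set 𝓑.carrier) (K : Π x : 𝓑.carrier, TangentSpace (𝓡 4) x),
      H6 𝓑 U → H7 𝓑 U → H8 𝓑 → H9 𝓑 U K → H10 𝓑 U K → H11 𝓑 U K → H12 𝓑 K → H13 𝓑 K →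
      H14 𝓑 U K → H15 𝓑 U → H16 𝓑 → Conclusion 𝓑 K

/-- **(F1′) `NonTrappingHawkingRigidity ↔ WithoutH4`** (pure logic over `h4_of_h2`): for provers,
`T ≠ 0` on the d.o.c. is free (no Carleman input needed); for the planner, h4 is decoration.
The Theses-free verbatim form is landed as
`Theorems/NonTrappingHawkingRigidity/Negative/KillingNonvanishingOfIPlusRegular.lean`. [folklore] -/
theorem iff_withoutH4 : NonTrappingHawkingRigidity ↔ WithoutH4 :=
  ⟨fun h 𝓑 _ h1 h2 h3 h5 U K ↦ h 𝓑 h1 h2 h3 (h4_of_h2 𝓑 h2) h5 U K,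
    fun h 𝓑 _ h1 h2 h3 _ h5 U K ↦ h 𝓑 h1 h2 h3 h5 U K⟩

/-! ## § (b) Trivial branches of the conclusion (positive special cases — information for provers,
not landable by this seat) -/

/-- **(F2) If the collar swallows the d.o.c. (`doc ⊆ U`) the conclusion is trivial** (`K' := K`,
`U' := U`): hypotheses h9–h11 restricted to `doc`. In particular a telescope instance whose `U`
contains the whole exterior carries no content. [folklore] -/
theorem conclusion_of_doc_subset [𝓑.metric.HasLeviCivita] (hU : 𝓑.doc ⊆ U) (h6 : H6 𝓑 U)
    (h7 : H7 𝓑 U) (h9 : H9 𝓑 U K) (h10 : H10 𝓑 U K) (h11 : H11 𝓑 U K) : Conclusion 𝓑 K :=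
  ⟨K, h9.mono hU, fun x hx ↦ h10 x (hU hx), fun x hx ↦ h11 x (hU hx), U, h6, h7, fun _ _ ↦ rfl⟩

/-- Constant multiples of the stationary Killing field are Killing fields (the Killing equation is
linear; `∇(c • T) = c • ∇T` by `IsCovariantDerivativeOn.smul_const` at the smooth section `T`).
O'Neill 1983, Ch. 9, Prop. 9.25. [cite: ONeill1983, Ch. 9, Prop. 9.25] -/
theorem isKillingField_const_smul_killing [𝓑.metric.HasLeviCivita] (c : ℝ) :
    𝓑.metric.IsKillingField (c • 𝓑.killing) := by
  have hT : 𝓑.metric.IsKillingField 𝓑.killing := 𝓑.isStationaryKilling.isKillingField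
  refine ⟨hT.contMDiff.const_smul_section, fun x Y₀ Z₀ ↦ ?_⟩
  have hTx : MDifferentiableAt (𝓡 4) (𝓡 4).tangent
      (fun y ↦ (⟨y, 𝓑.killing y⟩ : TangentBundle (𝓡 4) 𝓑.carrier)) x :=
    (hT.contMDiff x).mdifferentiableAt (by simp)
  have hs : 𝓑.metric.leviCivita (c • 𝓑.killing) x = c • 𝓑.metric.leviCivita 𝓑.killing x :=
    𝓑.metric.leviCivita.isCovariantDerivativeOnUniv.smul_const c hTx
  have h := hT.val_leviCivita_add x Y₀ Z₀
  simp only [hs, FunLike.coe_smul, Pi.smul_apply, map_smul, smul_eq_mul]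
  linear_combination c * h

/-- `[T, c • T] = 0` pointwise (`mlieBracket_const_smul_right` at the smooth section `T`, then
`mlieBracket_self`). [folklore] -/
theorem mlieBracket_killing_const_smul_killing [𝓑.metric.HasLeviCivita] (c : ℝ) (x : 𝓑.carrier) :
    VectorField.mlieBracket (𝓡 4) 𝓑.killing (c • 𝓑.killing) x = 0 := by
  have hT : 𝓑.metric.IsKillingField 𝓑.killing := 𝓑.isStationaryKilling.isKillingField
  have hTx : MDifferentiableAt (𝓡 4) (𝓡 4).tangent
      (fun y ↦ (⟨y, 𝓑.killing y⟩ : TangentBundle (𝓡 4) 𝓑.carrier)) x :=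
    (hT.contMDiff x).mdifferentiableAt (by simp)
  rw [VectorField.mlieBracket_const_smul_right hTx, VectorField.mlieBracket_self]
  simp

/-- **(F3) The NON-ROTATING branch is trivial AS TYPED.** If the collar field is a constant
multiple of `T` on `U₀ ∩ doc` for some open `U₀ ⊇ 𝓔⁺` (as it must be when `T` is timelike up to
the horizon: on Schwarzschild every admissible `K` is `c • T`, since `T + R`, `R ∈ so(3) ∖ 0`, is
spacelike at the horizon points where `R ≠ 0`), then `K' := c • T` proves the conclusion — no
axisymmetry is produced, none is claimed.  So the item's content is entirely in the ROTATING case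
(ergoregion touching `𝓔⁺`, where h14 forbids `K ∥ T`).  The informal gloss "(⇒ axisymmetry)" in the
docstring of stmt-13896 is false in this branch but is not part of the statement. [folklore] -/
theorem conclusion_of_collar_parallel [𝓑.metric.HasLeviCivita] {U₀ : Set 𝓑.carrier}
    (hU₀ : IsOpen U₀) (hh : 𝓑.horizon ⊆ U₀) {c : ℝ}
    (hK : ∀ x ∈ U₀ ∩ 𝓑.doc, K x = c • 𝓑.killing x) : Conclusion 𝓑 K := by
  have hcT := isKillingField_const_smul_killing 𝓑 c
  exact ⟨c • 𝓑.killing, hcT.contMDiff.contMDiffOn, fun x _ v w ↦ hcT.val_leviCivita_add x v w,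
    fun x _ ↦ mlieBracket_killing_const_smul_killing 𝓑 c x, U₀, hU₀, hh,
    fun x hx ↦ by rw [Pi.smul_apply, hK x hx]⟩

/-- **(F3′) Horizonless presentations are trivially TRUE instances, not counterexamples**: if
`𝓔⁺ = ∅` (excluded by h8, which demands `IsConnected`, hence non-empty) the conclusion holds with
`K' := 0`, `U' := ∅`.  Recorded to close the junk door "drop h8 and take Minkowski": dropping the
non-emptiness half of h8 does not falsify the item. [folklore] -/
theorem conclusion_of_horizon_empty [𝓑.metric.HasLeviCivita] (h : 𝓑.horizon = ∅) :
    Conclusion 𝓑 K := by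
  refine ⟨0, (Bundle.contMDiff_zeroSection ℝ (TangentSpace (𝓡 4) : 𝓑.carrier → Type _)).contMDiffOn,
    fun x _ v w ↦ (𝓑.metric.isKillingField_zero).val_leviCivita_add x v w, fun x _ ↦ ?_, ∅,
    isOpen_empty, by simp [h], fun x hx ↦ absurd hx.1 (Set.notMem_empty x)⟩
  simp only [VectorField.mlieBracket_zero_right, Pi.zero_apply]


/-! ## § (a′) The collar field's scale and time-orientation are free — kernel-checked

The six collar clauses h9–h14 and the conclusion are invariant under `K ↦ c • K` for every constant
`c ≠ 0` (h14 is quadratic, h13 sees reparametrised integral curves, the rest are linear).  So the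
telescope fixes NEITHER the orientation of `K` (future/past directed on `U ∩ doc`) NOR its scale
(`κ`, "`K = T + Ω_H Φ`" as an identity with a normalised `T`): any stub that speaks of "the surface
gravity of `K`", of `K` being future-directed, or of the NUMBER `Ω_H`, must first normalise `K`
(and `T`, cf. the sister crux's `StationaryFieldRescaling`, p75827) — the hypotheses do not. -/

section Scaling

variable {𝓑 U K}

/-- The d.o.c. of any presentation is open (`I^±` are open on the boundaryless carrier:
`isOpen_chronologicalFuture/Past_holds_of_boundaryless`). [folklore] -/
theorem isOpen_doc : IsOpen 𝓑.doc :=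
  𝓑.isOpen_doc LorentzianMetric.isOpen_chronologicalFuture_holds_of_boundaryless
    LorentzianMetric.isOpen_chronologicalPast_holds_of_boundaryless

/-- A section smooth on an open set is differentiable at its points (as a map into `TM`). [folklore] -/
theorem mdifferentiableAt_of_contMDiffOn {V : Set 𝓑.carrier} (hV : IsOpen V)
    (h : ContMDiffOn (𝓡 4) ((𝓡 4).prod 𝓘(ℝ, E4)) ((⊤ : ℕ∞) : WithTop ℕ∞)
      (fun x ↦ (Bundle.TotalSpace.mk' E4 x (K x) : TangentBundle (𝓡 4) 𝓑.carrier)) V)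
    {x : 𝓑.carrier} (hx : x ∈ V) :
    MDifferentiableAt (𝓡 4) (𝓡 4).tangent
      (fun y ↦ (⟨y, K y⟩ : TangentBundle (𝓡 4) 𝓑.carrier)) x :=
  ((h x hx).contMDiffAt (hV.mem_nhds hx)).mdifferentiableAt (by simp)

/-- h9 is invariant under `K ↦ c • K`. [folklore] -/
theorem H9.const_smul (h : H9 𝓑 U K) (c : ℝ) : H9 𝓑 U (c • K) :=
  ContMDiffOn.const_smul_section h

/-- h10 (Killing on the open `U`, given h9) passes to `c • K`: `∇(c • K) = c • ∇K` at smooth points. [folklore] -/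
theorem H10.const_smul [𝓑.metric.HasLeviCivita] (h6 : H6 𝓑 U) (h9 : H9 𝓑 U K) (h : H10 𝓑 U K)
    (c : ℝ) : H10 𝓑 U (c • K) := by
  intro x hx v w
  have hs : 𝓑.metric.leviCivita (c • K) x = c • 𝓑.metric.leviCivita K x :=
    𝓑.metric.leviCivita.isCovariantDerivativeOnUniv.smul_const c
      (mdifferentiableAt_of_contMDiffOn h6 h9 hx)
  have h' := h x hx v w
  simp only [hs, FunLike.coe_smul, Pi.smul_apply, map_smul, smul_eq_mul]
  linear_combination c * h'

/-- h11 (`[T, K] = 0` on the open `U`, given h9) passes to `c • K`. [folklore] -/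
theorem H11.const_smul (h6 : H6 𝓑 U) (h9 : H9 𝓑 U K) (h : H11 𝓑 U K) (c : ℝ) :
    H11 𝓑 U (c • K) := by
  intro x hx
  rw [VectorField.mlieBracket_const_smul_right (mdifferentiableAt_of_contMDiffOn h6 h9 hx), h x hx,
    smul_zero]

/-- h12 passes to `c • K`, `c ≠ 0`. [folklore] -/
theorem H12.const_smul (h : H12 𝓑 K) {c : ℝ} (hc : c ≠ 0) : H12 𝓑 (c • K) :=
  fun p hp ↦ by simpa [hc] using h p hp

/-- h13 passes to `c • K`, `c ≠ 0` (integral curves of `c • K` are reparametrised integral curves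
of `K`, `IsMIntegralCurve.comp_mul`). [folklore] -/
theorem H13.const_smul (h : H13 𝓑 K) {c : ℝ} (hc : c ≠ 0) : H13 𝓑 (c • K) := by
  intro γ hγ h0 t
  have hγ' : IsMIntegralCurve (γ ∘ (· * c⁻¹)) K := by
    simpa [smul_smul, inv_mul_cancel₀ hc] using hγ.comp_mul c⁻¹
  have h' := h _ hγ' (by simpa using h0) (t * c)
  simpa [mul_assoc, mul_inv_cancel₀ hc] using h'

/-- h14 (timelike collar) passes to `c • K`, `c ≠ 0`: `g(cK, cK) = c² g(K, K)`. [folklore] -/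
theorem H14.const_smul (h : H14 𝓑 U K) {c : ℝ} (hc : c ≠ 0) : H14 𝓑 U (c • K) := by
  intro x hx
  have h' := h x hx
  have hc2 : 0 < c * c := mul_self_pos.mpr hc
  simp only [Pi.smul_apply, map_smul, FunLike.coe_smul, smul_eq_mul]
  nlinarith

/-- The conclusion passes to `c • K` (extend by `c • K'`). [folklore] -/
theorem Conclusion.const_smul [𝓑.metric.HasLeviCivita] (h : Conclusion 𝓑 K) (c : ℝ) :
    Conclusion 𝓑 (c • K) := by
  obtain ⟨K', hsm, hkil, hbr, U', hU', hh, hdock⟩ := h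
  refine ⟨c • K', ContMDiffOn.const_smul_section hsm, fun x hx v w ↦ ?_, fun x hx ↦ ?_, U', hU', hh,
    fun x hx ↦ by rw [Pi.smul_apply, Pi.smul_apply, hdock x hx]⟩
  · have hs : 𝓑.metric.leviCivita (c • K') x = c • 𝓑.metric.leviCivita K' x :=
      𝓑.metric.leviCivita.isCovariantDerivativeOnUniv.smul_const c
        (mdifferentiableAt_of_contMDiffOn isOpen_doc hsm hx)
    have h' := hkil x hx v w
    simp only [hs, FunLike.coe_smul, Pi.smul_apply, map_smul, smul_eq_mul]
    linear_combination c * h'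
  · rw [VectorField.mlieBracket_const_smul_right (mdifferentiableAt_of_contMDiffOn isOpen_doc hsm hx),
      hbr x hx, smul_zero]

/-- **(F4) The collar clauses h9–h14 are invariant under `K ↦ c • K`, `c ≠ 0`** (given h6). [folklore] -/
theorem collar_const_smul_iff [𝓑.metric.HasLeviCivita] (h6 : H6 𝓑 U) {c : ℝ} (hc : c ≠ 0) :
    (H9 𝓑 U K ∧ H10 𝓑 U K ∧ H11 𝓑 U K ∧ H12 𝓑 K ∧ H13 𝓑 K ∧ H14 𝓑 U K) ↔
      (H9 𝓑 U (c • K) ∧ H10 𝓑 U (c • K) ∧ H11 𝓑 U (c • K) ∧ H12 𝓑 (c • K) ∧ H13 𝓑 (c • K) ∧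
        H14 𝓑 U (c • K)) := by
  constructor
  · rintro ⟨h9, h10, h11, h12, h13, h14⟩
    exact ⟨h9.const_smul c, h10.const_smul h6 h9 c, h11.const_smul h6 h9 c, h12.const_smul hc,
      h13.const_smul hc, h14.const_smul hc⟩
  · rintro ⟨h9, h10, h11, h12, h13, h14⟩
    have hK : c⁻¹ • (c • K) = K := by rw [smul_smul, inv_mul_cancel₀ hc, one_smul]
    have hc' : c⁻¹ ≠ 0 := inv_ne_zero hc
    exact ⟨hK ▸ h9.const_smul c⁻¹, hK ▸ h10.const_smul h6 h9 c⁻¹, hK ▸ h11.const_smul h6 h9 c⁻¹,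
      hK ▸ h12.const_smul hc', hK ▸ h13.const_smul hc', hK ▸ h14.const_smul hc'⟩

/-- **(F4′) … and so is the conclusion.** [folklore] -/
theorem conclusion_const_smul_iff [𝓑.metric.HasLeviCivita] {c : ℝ} (hc : c ≠ 0) :
    Conclusion 𝓑 K ↔ Conclusion 𝓑 (c • K) := by
  refine ⟨fun h ↦ h.const_smul c, fun h ↦ ?_⟩
  have hK : c⁻¹ • (c • K) = K := by rw [smul_smul, inv_mul_cancel₀ hc, one_smul]
  exact hK ▸ h.const_smul c⁻¹

end Scaling


/-! ## § (c)/(e) Natural strengthenings and dropped hypotheses — NEAR-MISSES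

The two statements below are FALSE on paper; their witnesses are perturbations / re-dressings of a
sub-extremal Kerr presentation of the telescope, which the tree cannot yet construct (no
`StationaryAFBlackHole` inhabitant with `IsIPlusRegular` PROVED exists: `Kerr.stationaryAFBlackHole`
is built modulo `Kerr.Facts`/`SliceFacts`/`isAsymptoticallyFlat_data` and its d.o.c., `I⁺`-regular
hypersurface and h16 (support item stmt-13857, chart form only) are not in the kernel).  Hence
`sorry`: permitted in this work file only; each docstring carries the witness and the obstruction. -/

/-- The crux with h1 (VACUUM) deleted. -/
def WithoutH1 : Prop :=
  ∀ (𝓑 : StationaryAFBlackHole.{0}) [𝓑.metric.HasLeviCivita],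
    H2 𝓑 → H3 𝓑 → H4 𝓑 → H5 𝓑 →
    ∀ (U : Set 𝓑.carrier) (K : Π x : 𝓑.carrier, TangentSpace (𝓡 4) x),
      H6 𝓑 U → H7 𝓑 U → H8 𝓑 → H9 𝓑 U K → H10 𝓑 U K → H11 𝓑 U K → H12 𝓑 K → H13 𝓑 K →
      H14 𝓑 U K → H15 𝓑 U → H16 𝓑 → Conclusion 𝓑 K

/-- **(F5) h1 (vacuum) IS load-bearing — and it is needed in the region where `T` is TIMELIKE, not
only in the ergoregion.**  `WithoutH1` is false.  NEAR-MISS (witness on paper, `sorry` here).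

*Witness.*  Let `(M, g)` be a rotating sub-extremal Kerr presentation of the telescope (ingoing
Kerr–Schild carrier `{r > r₀}`, `r₀ < r₊`, so that h3 holds; `T = ∂_{t*}`; collar `U := {r < r₊ + δ₀}`,
`K := ∂_{t*} + Ω_H ∂_{φ*}`, timelike on `U ∩ doc` for `0 < |a| < M`; h16 on Kerr = support item
stmt-13857: `R₀′(r) = −2(r − M)(L² + Q) < 0`).  Choose an exterior point `q` with `g(T,T)(q) < 0`
(outside the CLOSED ergoregion), off the axis and with `r(q) > r₊ + δ₀`, a small ball `B ∋ q` in the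
slice through `q` whose closure stays in that open region, and let `W := ⋃ₜ φₜ(B)` (a `T`-tube).
Let `h` be a smooth symmetric 2-tensor with `supp h ⊆ W`, `𝓛_T h = 0`, `‖h‖_{C²} < ε` (uniformly:
`h` is `t*`-independent), NOT axisymmetric and generic (below), and put `g̃ := g + h` on the same
carrier, same slice/end/embedding (the induced data `(h̃, k̃)` change only inside `B`; the structure
`InitialDataSet` carries no constraint equations and the AF decay lives at infinity), same `T`.
* *h2–h16 survive for `ε` small.*  `T` is `g̃`-Killing (`𝓛_T h = 0`), complete, timelike on `W̄`
  and on `M_ext` (unchanged far out).  Zero-energy null vectors of `g̃` exist only where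
  `g̃(T,T) ≥ 0`, i.e. (for `ε` small, `W̄ ⊆ {g(T,T) < 0}` compact mod `T`) exactly on Kerr's closed
  ergoregion ∪ black-hole region, where `g̃ = g`: so the maximal zero-energy null `g̃`-geodesics are
  the maximal zero-energy null Kerr geodesics (they never meet `W`), and h16, h15 hold verbatim as on
  Kerr; `U ∩ W = ∅`, so h9–h14 hold verbatim (`K` Killing is a local condition).  `M_ext` is the same
  set; `doc(g̃) = doc(g) = {r > r₊}` and `horizon(g̃) = {r = r₊}`: in `{r ≤ r₊}` nothing changed and
  no future causal curve crosses `{r = r₊}` outward (locally Kerr), while every exterior point still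
  reaches and is reached from the far region by timelike curves dodging or crossing the thin tube
  (`T` is `g̃`-timelike on `W̄`, so `T + η ∂_r` exits `W̄`; mod `T` the family of points to serve is
  compact, so one `ε` works) — hence h3, h4, h5, h7, h8 hold.  h2: `t*` is a `g`-temporal function
  with `g(∇t*, ∇t*) ≤ −c < 0` on `W̄` mod `T`, so it stays `g̃`-temporal for `ε` small; `{t* = 0} ∩ doc`
  is again a Cauchy surface of the (causally convex) d.o.c. and its closure meets every generator of
  `{r = r₊}` once — the Chruściel–Costa hypersurface of Kerr serves `g̃` (its spacelikeness/acausality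
  are open conditions mod `T`), and compactness of causal diamonds of the d.o.c. follows from global
  hyperbolicity of `(doc, g̃|)`.  (Soft step 1: stability of global hyperbolicity of the Kerr exterior
  under `C²`-small STATIONARY perturbations supported in a tube — standard via the uniformly temporal
  function `t*`; not in print in this exact form.)
* *The conclusion FAILS for `(g̃, U, K)`.*  Suppose `K'` is `g̃`-Killing on `doc`, `[T, K'] = 0`,
  `K' = K` on `U' ∩ doc`.  On the connected open set `doc ∖ W̄ ⊇ U' ∩ doc ∩ {r < r₊ + δ₀}` the metric is
  Kerr, whose Killing algebra on every connected open set is `span{T, Φ}` (Kerr has no local Killing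
  fields beyond `∂_t, ∂_φ`: the two real invariants of the Weyl spinor, `Re/Im (M/(r − i a cos θ)³)`,
  have independent gradients off a null set, so a Killing field is tangent to the `(t, φ)`-tori and
  then constant-coefficient), and Killing fields are determined by their 1-jet at a point; hence
  `K' = T + Ω_H Φ` on `doc ∖ W̄`, and `Z := (K' − T)/Ω_H` (`Ω_H ≠ 0` as `a ≠ 0`) is a `g̃`-Killing field
  on `doc` equal to `Φ` on `doc ∖ W̄`, and `[T, Z] = 0`.  Choose `h` so that NO `T`-commuting
  `g̃`-Killing field near `q` is transversal to `T` — an explicit OPEN condition, not a genericity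
  prayer: `T`-commuting Killing fields of `g̃` on a ball `N ∋ q`, `N ⊆ W`, descend to Killing fields
  of the Kaluza–Klein quotient data on `N/T` (3-metric `γ̃ = g̃ + T♭⊗T♭/|g̃(T,T)|` on the orbit space,
  twist form, lapse `−g̃(T,T)`), and a `T`-invariant `h` realises an ARBITRARY `C²`-small perturbation
  of `γ` on the 3-ball `B`; take one for which three scalar curvature invariants of `γ̃` have linearly
  independent gradients at `q̄` (then `γ̃` has no non-zero Killing field near `q̄`).  Hence every
  `T`-commuting `g̃`-Killing field on `N` is vertical, `Z = f T`; `[T, fT] = 0` gives `T f = 0`, and the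
  Killing equation for `fT` (with `T` Killing) reads `df ⊗ T♭ + T♭ ⊗ df = 0`, forcing `df = 0` (`T ≠ 0`):
  `Z = c T` on `N`.  So the `g̃`-Killing field `Z − cT` on the connected `doc` vanishes on an open set,
  hence everywhere (1-jet rigidity of Killing fields of a smooth metric), i.e. `Φ = cT` on `doc ∖ W̄`
  — absurd (`Φ` vanishes on the axis, `T` does not).  So no `K'` exists: `¬ Conclusion`.  (Only soft
  step: stability of h2, above.)

*What provers should read off.*  The witness has the SAME horizon, collar, ergoregion, belt and
zero-energy optics as Kerr; it differs from Kerr only on a tube where `T` is timelike.  Therefore any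
proof of the crux must extract information from `Ric = 0` ON `{g(T,T) < 0} ∖ U` as well — e.g.
real-analyticity there (Müller zum Hagen 1970, route AIE's `SeedsAtBothEnds`) + Nomizu/analytic
continuation, or Carleman unique continuation for `□_g`-type consequences of the vacuum equations
across the (automatically `T`-conditionally pseudo-convex, since no `T`-orthogonal null vectors exist
there) level sets — and not only in the ergoregion belt where h16 does its work.  An engine that is
"belt analysis + abstract Killing continuation outward" cannot close the item.

*Obstruction to a kernel proof here.*  Needs (i) a Kerr inhabitant of h2–h16 in the tree, (ii) the
perturbed presentation as a `StationaryAFBlackHole` with h2 re-proved, (iii) the local Killing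
algebra of Kerr, the Kaluza–Klein reduction of `T`-commuting Killing fields and 1-jet rigidity of
Killing fields — none in the tree.  Literature (from this seat's memory; remote search was degraded at
write time — S2/OpenAlex/arXiv HTTP 429, local searchd reset —, so treat as pointers, not checked
cites): no asymptotically flat ROTATING single-Killing-field black hole WITH reasonable matter seems to
be in print (the single-Killing-field holes of Dias–Horowitz–Santos, arXiv:1105.4167, and the black
resonators of Dias–Santos–Way, arXiv:1505.04793, are asymptotically AdS; the flat-space
non-axisymmetric Einstein–Yang–Mills(–Higgs) holes of Ridgway–Weinberg 1995 are STATIC, where the item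
is trivially true by (F3)); the witness above is therefore a no-field-equation metric, which is all
`WithoutH1` asks. [folklore] -/
theorem false_without_H1 : ¬ WithoutH1 := by
  sorry

/-- The conclusion STRENGTHENED to dock on the given collar set `U` itself (no `∃ U'`). -/
def ConclusionDockOnU [𝓑.metric.HasLeviCivita] : Prop :=
  ∃ K' : Π x : 𝓑.carrier, TangentSpace (𝓡 4) x,
  ContMDiffOn (𝓡 4) ((𝓡 4).prod 𝓘(ℝ, E4)) ((⊤ : ℕ∞) : WithTop ℕ∞)
    (fun x ↦ (Bundle.TotalSpace.mk' E4 x (K' x) : TangentBundle (𝓡 4) 𝓑.carrier)) 𝓑.doc ∧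
  (∀ x ∈ 𝓑.doc, ∀ v w : TangentSpace (𝓡 4) x,
    𝓑.metric.val x (𝓑.metric.leviCivita K' x v) w + 𝓑.metric.val x v (𝓑.metric.leviCivita K' x w) = 0) ∧
  (∀ x ∈ 𝓑.doc, VectorField.mlieBracket (𝓡 4) 𝓑.killing K' x = 0) ∧
  ∀ x ∈ U ∩ 𝓑.doc, K' x = K x

/-- Docking on `U` implies the typed conclusion (with `U' := U`). [folklore] -/
theorem conclusion_of_dockOnU [𝓑.metric.HasLeviCivita] (h6 : H6 𝓑 U) (h7 : H7 𝓑 U)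
    (h : ConclusionDockOnU 𝓑 U K) : Conclusion 𝓑 K := by
  obtain ⟨K', h1, h2, h3, h4⟩ := h
  exact ⟨K', h1, h2, h3, U, h6, h7, h4⟩

/-- The crux with the conclusion strengthened to `ConclusionDockOnU`. -/
def DockOnU : Prop :=
  ∀ (𝓑 : StationaryAFBlackHole.{0}) [𝓑.metric.HasLeviCivita],
    H1 𝓑 → H2 𝓑 → H3 𝓑 → H4 𝓑 → H5 𝓑 →
    ∀ (U : Set 𝓑.carrier) (K : Π x : 𝓑.carrier, TangentSpace (𝓡 4) x),
      H6 𝓑 U → H7 𝓑 U → H8 𝓑 → H9 𝓑 U K → H10 𝓑 U K → H11 𝓑 U K → H12 𝓑 K → H13 𝓑 K →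
      H14 𝓑 U K → H15 𝓑 U → H16 𝓑 → ConclusionDockOnU 𝓑 U K

/-- The strengthened crux implies the crux (pure logic). [folklore] -/
theorem nonTrappingHawkingRigidity_of_dockOnU (h : DockOnU) : NonTrappingHawkingRigidity :=
  fun 𝓑 _ h1 h2 h3 h4 h5 U K h6 h7 h8 h9 h10 h11 h12 h13 h14 h15 h16 ↦
    conclusion_of_dockOnU 𝓑 U K h6 h7 (h 𝓑 h1 h2 h3 h4 h5 U K h6 h7 h8 h9 h10 h11 h12 h13 h14 h15 h16)

/-- **(F6) The `∃ U'` of the conclusion is NECESSARY: docking on the given `U` is false** (tightness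
of the planner's typing; NEAR-MISS, witness on paper).  The hypotheses never ask `U` to be connected
or `T`-invariant.  *Witness.*  Rotating sub-extremal Kerr in the telescope with
`U := {r < r₊ + δ₀} ∪ W`, `W := ⋃ₜ φₜ(B)` a `T`-tube around a ball `B` in the far region where `T`
is timelike, and `K := ∂_{t*} + Ω_H ∂_{φ*}` on the collar component, `K := ∂_{t*}` (`= T`) on `W`.
h6–h14 hold (Killing, `[T,K] = 0`, timelike on both components; h12, h13 only see the collar), h15
is easier for the bigger `U`, h16 is unchanged.  A `T`-commuting Killing `K'` on the connected `doc`
docking on the collar component is `T + Ω_H Φ` everywhere (local Killing algebra of Kerr + 1-jet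
rigidity, as in (F5)), and `T + Ω_H Φ ≠ T` on `W` (off the axis `Φ ≠ 0`): no `K'` docks on all of
`U ∩ doc`.  For provers: dock only on the horizon component of `U`; for the planner: the typing is
right as it stands (do not "simplify" `∃ U'` away).  Obstruction to a kernel proof: as in (F5)(i),(iii).
[folklore] -/
theorem not_dockOnU : ¬ DockOnU := by
  sorry

/-! ## § (F7) Remarks for provers and the planner (no kernel content) -/

/-- **(F7) Junk survey and typing remarks** (why no `¬ NonTrappingHawkingRigidity` is claimed, and
what the letter of the telescope does and does not give).

1. *No kill.*  As typed the item is WEAKER than the Alexakis–Ionescu–Klainerman conjecture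
   (IonescuKlainerman2015 §4, p. 13: "any AF, regular, stationary vacuum solution which admits no
   trapped null geodesics perpendicular to `T` must be isometric to the exterior of a non-extremal
   Kerr"): it is handed the collar `(U, K)` (AIK's local rigidity output), `I⁺`-regularity, future
   presentation, belt compactness, and concludes only the Hawking extension, not Kerr.  A refutation is
   a counterexample to that conjecture; none is in print, no smooth non-Kerr stationary AF vacuum hole
   is known (ledger negatives for the summit: 0 relevant; barrier `IonescuKlainermanNonExtension` =
   IK 2013 Thm 1.3 is LOCAL, one-sided, and assumed away by the two-sided collar h9–h14).
2. *Junk inhabitants.*  `𝓔⁺ = ∅` (Minkowski, exterior-only charts) is excluded by h8 and would anyway be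
   a TRUE instance (`conclusion_of_horizon_empty`).  Static / non-rotating collars (`K ∥ T` near `𝓔⁺`)
   are TRUE instances (`conclusion_of_collar_parallel`).  `U ⊇ doc` is a TRUE instance
   (`conclusion_of_doc_subset`).  On Kerr every admissible `K` is `c (T + Ω_H Φ)` on the horizon
   component of `U` (Killing + `[T,K]=0` ⇒ `aT + bΦ`; timelike on `U ∩ doc` up to the non-polar horizon
   points ⇒ causal limit on `𝓔⁺` ⇒ `b = aΩ_H`), which extends: no junk-`K` attack.  `T ↦ T + cΦ` is not
   available as `𝓑.killing` (not timelike on the unbounded far region `M_ext`), which is exactly what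
   distinguishes `T` in IK's closing remark (loc. cit.: continuation from the horizon alone cannot tell
   `T` from `T + cZ`).  ℤ-quotients in `t` are killed by h5/h2, axis-removed ℤₖ-quotients by the `S²` AF
   end of the structure.  Carriers extended beyond the Cauchy horizon (even into Carter's CTC region)
   are ALLOWED (h2 asks global hyperbolicity of `doc` only, h3 holds there) but change neither `doc`,
   `𝓔⁺`, the collar nor the conclusion.
3. *h13 is weaker than "tangent".*  It constrains only WHOLE-LINE integral curves of `K`
   (`IsMIntegralCurve`); where `K|_{𝓔⁺}` is incomplete it is vacuous.  Geometric tangency must be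
   DERIVED: from h14 + continuity `K` is causal on `𝓔⁺ ⊆ closure (U ∩ doc)` (h3 gives
   `𝓔⁺ ⊆ closure doc`), and a causal vector tangent… is the generator direction only once `𝓔⁺` is known
   to be a null hypersurface; or prove completeness of `K` along `𝓔⁺` first.  The dock crux
   HawkingExtensionIsKerr (stmt-17840) inherits the same clause.
4. *h15 shapes `U` only inside the ergoregion.*  It forces `U ⊇ doc ∩ {g(T,T) ≥ 0} ∩ {"r" < r_min(S₀)}`
   — a collar that pinches at the poles of `𝓔⁺` (where the ergosurface meets the horizon) and says
   nothing where `T` is timelike; `U` need not be `T`-invariant nor connected ((F6)).  A `T`-invariant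
   collar is available WLOG only after a Killing 1-jet-rigidity argument along `𝓔⁺` (flowing `K` by
   `φₜ` is consistent because `j¹K` at horizon points is `φₜ`-invariant by h11 and `𝓔⁺ ⊆ U`).
5. *Normalisations are invisible.*  `K ↦ cK` ((F4)) and `T ↦ cT`, `c > 0` (sister crux
   ZeroEnergyRigidity (F10), `StationaryFieldRescaling`, p75827: same `M_ext`, `doc`, `𝓔⁺`, orbits;
   here h11, h15, h16 are visibly invariant — brackets and zero-energy conditions are linear in `T`,
   orbits of `cT` are reparametrised orbits of `T`) leave every clause invariant: `κ`, `Ω_H`,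
   "future-directed `K`", "`g(T,T) → −1`" are not in the hypotheses.
6. *h4 is decoration* ((F1), landed); *h5* is believed redundant by topological censorship
   (Chruściel–Wald 1994; Galloway 1995) given h2 — no tree fact, not claimed; *h8 → `Nonempty`*: no
   multi-component smooth stationary vacuum configuration is known, so connectedness proper is not
   known to be load-bearing for truth (it is for the proof: one collar component); *h14* excludes
   extreme Kerr (planner's numbers: `K` spacelike just outside `𝓔⁺` for `sin θ > √3 − 1`) — but extreme
   Kerr SATISFIES the conclusion (`T + Ω_H Φ` extends), so h14 is load-bearing for the METHOD (`κ ≠ 0`,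
   AIK/IK Carleman weights at a non-degenerate horizon), not visibly for truth; *h16 dropped* =
   unconditional smooth Hawking rigidity, open, no witness either way; *h1 dropped*: FALSE ((F5)).
7. *Uniqueness of `K'`* (strengthening `∃` to `∃!` up to the docking set) is TRUE on paper (1-jet
   rigidity on the connected `doc`), so not a refutation target; *"`K'` timelike on `doc`"* is a FALSE
   strengthening on rotating Kerr (light cylinder; cf. the ledger's `KerrNoTimelikeKillingCombination`),
   again needing the Kerr inhabitant for a kernel proof. [folklore] -/
theorem junk_survey : True := trivial


/-! ## § (F8) Docking is non-vacuous — kernel-checked -/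

/-- Under h3 the d.o.c. is the chronological past of `M_ext`. [folklore] -/
theorem doc_eq_chronologicalPast_of_H3 (h3 : H3 𝓑) :
    𝓑.doc = 𝓑.metric.chronologicalPast 𝓑.timeOrientation 𝓑.Mext :=
  Set.ext fun x ↦ ⟨fun h ↦ h.2, fun h ↦ ⟨h3 x, h⟩⟩

/-- **(F8) `𝓔⁺ ⊆ closure doc` for EVERY presentation** — h3 is not even needed: the tree theorem
`StationaryAFBlackHole.horizon_subset_closure_doc` (`𝓔⁺ = ∂⟨⟨M_ext⟩⟩ ∩ I⁺(M_ext)`, CCH12 §2.4) at the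
proved openness facts `isOpen_chronologicalFuture/Past_holds_of_boundaryless`.  (Under h3 it is also
the one-liner `𝓔⁺ ⊆ ∂I⁻ ⊆ closure I⁻ = closure doc`, `doc_eq_chronologicalPast_of_H3`.)
[cite: ChruscielCostaHeusler2012, §2.4] -/
theorem horizon_subset_closure_doc : 𝓑.horizon ⊆ closure 𝓑.doc :=
  𝓑.horizon_subset_closure_doc LorentzianMetric.isOpen_chronologicalFuture_holds_of_boundaryless
    LorentzianMetric.isOpen_chronologicalPast_holds_of_boundaryless

/-- **(F8′) Hence the docking clause is non-vacuous**: every open `U' ⊇ 𝓔⁺` meets the d.o.c. as soon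
as `𝓔⁺ ≠ ∅` (h8).  Consequently the junk candidates `K' := 0` and `K' := c • T` dock only in the
branches of (F3)/(F3′) (`K ∥ T` near `𝓔⁺`, resp. `𝓔⁺ = ∅`); in the rotating case (h14 with an
ergoregion touching `𝓔⁺`) they are dead. [folklore] -/
theorem docking_nonvacuous (h8 : H8 𝓑) {U' : Set 𝓑.carrier} (hU' : IsOpen U')
    (hh : 𝓑.horizon ⊆ U') : (U' ∩ 𝓑.doc).Nonempty := by
  obtain ⟨p, hp⟩ := h8.nonempty
  have h := horizon_subset_closure_doc 𝓑 hp
  rw [mem_closure_iff] at h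
  exact h U' hU' (hh hp)


/-! ## § (F9) Pre-triage of the round-1 idea cards' first lemmas (disprover's junk probes only;
the triage panel grades them) -/

/-- **(F9) The three first lemmas in `Cruxes/NonTrappingHawkingRigidity/SketchIdeator{1,2}.lean`
survive the disprover's cheap probes** (20 min each; no kernel content here).
* `Ideator1.TwoKillingNonNullContinuation` (card azimuthal-partial-analyticity): = Tataru 1995/1999 –
  Robbiano–Zuily – Hörmander with `x_a = (t, φ)` in a flow box of the commuting pair `(T, Z)`.
  Degenerate branch `Z ∥ T` at `x₀` is consistent (then `T` itself is timelike at `x₀` and ONE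
  analytic variable already empties the residual set `Char ∩ {ξ(T) = 0}`); `g(n,n) ≠ 0` makes the
  surface non-characteristic; the conclusion's `V` may be taken inside `W`, so the junk values of `u`
  off `W` are harmless.  No cheap kill; in print modulo transcription.
* `Ideator1.NoEternalCompactWavesWithTwoKillingFields`: the max-height argument needs (i) the level
  sets of the `(T,Z)`-invariant height to be non-null — AUTOMATIC (`df ≠ 0` annihilates the timelike
  plane `span{T,Z}`, so `∇f` is spacelike: `OrthogonalOfTimelikePlaneIsSpacelike` on covectors) — and
  (ii) since `u` is NOT `T`-invariant, the supremum of `f` on `{u ≠ 0}` is in general approached only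
  along `t → ∞`: use the translates `u ∘ φ_t` (again solutions, same support bound) and the UNIFORM
  size of the unique-continuation neighbourhood at the limit point `s₀ ∈ S` (it depends on the
  operator and the surface, not on `u`).  With that remark: true on paper; no cheap kill.
* `Ideator2.AzimuthalTataruLiouville` (card azimuthal-time-tataru): branch `Φ := T` is admissible
  (`[T,T] = 0`) and then `NoAxialFreeZeroEnergyLight` says `T` timelike on `W` — the statement becomes
  elliptic unique continuation for the `T`-reduced operator (Aronszajn–Cordes), true; where `T` is
  spacelike the hypothesis forces `T, Φ` independent with timelike span, Tataru applies (`V`, `Y`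
  invariant under BOTH fields on `W` is exactly the partial analyticity; `u` only `T`-invariant is
  fine); here `u` IS `T`-invariant so the max-height point is attained on `S` directly.  No cheap kill.
* `Ideator2.AxisymmetricStuffingRigidity` (card azimuthal-c-energy, first fruit): `S := ∅` is a TRUE
  instance (then `g' = g` pointwise and `Φ' := Φ`, after transporting the Killing equation along
  `g'.val = g.val`); `g'` is required Ricci-flat on the WHOLE carrier and `= g` off `orbit_T(S)`, so
  no (F5)-type non-vacuum stuffing applies; Ionescu–Klainerman local hair (barrier
  `IonescuKlainermanNonExtension`) is LOCAL (one side of a hypersurface in a small domain), not a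
  smooth global stuffing compact mod `T`, so it does not instantiate the lemma's `g'`.  No cheap kill;
  the lemma is a genuine open statement (it is stuffing rigidity WITHOUT non-trapping).
* Exposure to (F5) for all three cards: every engine that acts only in the belt must still continue
  the axial field through `{g(T,T) < 0} ∖ U`; all three do so legitimately (Tataru with `T` timelike
  there / elliptic analyticity on the Ernst side), i.e. they DO use `Ric = 0` (through `□_g`-type
  equations or Müller zum Hagen) outside the belt — consistent with (F5), nothing to repair. [folklore] -/
theorem ideas_pretriage : True := trivial

end

end Summit.FinalStateConjecture.FinalStateConjecture.Cruxes.NonTrappingHawkingRigidity.Disproof
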